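import Literature.MathematicalPhysics.QuantumFieldTheory.PointwiseOSReconstruction
import Literature.Probability.LatticeModels.ConformalCovariance
import HarnessLib

/-!
# Range congruence of normalised permutation-symmetric correlation families

For a correlation family `S : CorrFamily 3` which vanishes at non-injective (coincident)
configurations and is permutation symmetric, the value `S n x` only depends on the range
`Set.range x ⊆ ℝ³` of the configuration `x : Fin n → ℝ³` (for a fixed arity `n`):

* `stub_corr_eq_of_range_eq` : `Set.range x = Set.range x' → S n x = S n' x'` (`n = n'`);
* `stub_corr_eq_of_range_eq_add` : adding translation invariance, `S n' x' = S n x` whenever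
  `Set.range x'` is the translate `Set.range x + v`.

The point is that if `x` is injective and `Set.range x = Set.range x'` with the same arity, then
`x' = x ∘ σ` for a permutation `σ` (a surjection `Fin n → Fin n` is a bijection); and if neither
`x` nor `x'` is injective both sides vanish.

We also record small range computations used by the crux file: `mem_range_fin_append`
(pointwise form of `Set.range (Fin.append u v) = Set.range u ∪ Set.range v`), `range_matrix_one`,
`range_const_fin_one`, `range_comp_add`.
-/

noncomputable section

open Literature.Probability.LatticeModels
open Literature.MathematicalPhysics.QuantumFieldTheory

namespace Summit.CriticalPhenomena.Ising3DConformalLimit.Cruxes.RotationUpgradeFromTwoPoint.NullLaplacianEdgeGaussianity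

/-! ## Range computations -/

/-- Membership in the range of `Fin.append u v`: `a` is a value of `u` or a value of `v`. This is
the pointwise form of `Set.range (Fin.append u v) = Set.range u ∪ Set.range v` (landed as
`Literature.AlgebraicGeometry.Resolution.range_fin_append`); the equation is recovered as
`Set.ext fun _ => mem_range_fin_append`. [folklore] -/
theorem mem_range_fin_append {α : Type*} {m n : ℕ} {u : Fin m → α} {v : Fin n → α} {a : α} :
    a ∈ Set.range (Fin.append u v) ↔ a ∈ Set.range u ∨ a ∈ Set.range v := by
  constructor
  · rintro ⟨i, rfl⟩
    refine Fin.addCases (fun j => ?_) (fun j => ?_) i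
    · exact Or.inl ⟨j, (Fin.append_left u v j).symm⟩
    · exact Or.inr ⟨j, (Fin.append_right u v j).symm⟩
  · rintro (⟨j, rfl⟩ | ⟨j, rfl⟩)
    · exact ⟨Fin.castAdd n j, Fin.append_left u v j⟩
    · exact ⟨Fin.natAdd m j, Fin.append_right u v j⟩

/-- The range of the one-entry vector `![a]` is `{a}`. [folklore] -/
theorem range_matrix_one {α : Type*} (a : α) : Set.range ![a] = {a} :=
  Matrix.range_cons_empty a _

/-- The range of a constant configuration `fun _ : Fin 1 => a` is `{a}`. [folklore] -/
theorem range_const_fin_one {α : Type*} (a : α) : Set.range (fun _ : Fin 1 => a) = {a} :=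
  Set.range_const

/-- The range of a translated configuration is the translate of the range. [folklore] -/
theorem range_comp_add {n : ℕ} (x : Fin n → EuclideanSpace ℝ (Fin 3))
    (v : EuclideanSpace ℝ (Fin 3)) :
    Set.range (fun i => x i + v) = (fun p => p + v) '' Set.range x :=
  Set.range_comp (fun p => p + v) x

/-! ## Equal ranges give a permutation -/

/-- If `x : Fin n → α` is injective and `x' : Fin n → α` has the same range, then `x' = x ∘ σ`
for a permutation `σ` of `Fin n`. [folklore] -/
theorem exists_perm_of_range_eq {α : Type*} {n : ℕ} {x x' : Fin n → α}
    (hx : Function.Injective x) (hr : Set.range x = Set.range x') :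
    ∃ σ : Equiv.Perm (Fin n), x' = x ∘ σ := by
  have h1 : ∀ i, ∃ j, x j = x' i := fun i => by
    have hi : x' i ∈ Set.range x := hr ▸ Set.mem_range_self i
    exact hi
  choose f hf using h1
  have hfs : Function.Surjective f := by
    intro j
    obtain ⟨i, hi⟩ : x j ∈ Set.range x' := hr ▸ Set.mem_range_self j
    exact ⟨i, hx (by rw [hf, hi])⟩
  exact ⟨Equiv.ofBijective f hfs.bijective_of_finite, funext fun i => (hf i).symm⟩

/-- If `x x' : Fin n → α` have the same range, then `x` is injective iff `x'` is. [folklore] -/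
theorem injective_iff_of_range_eq {α : Type*} {n : ℕ} {x x' : Fin n → α}
    (hr : Set.range x = Set.range x') : Function.Injective x ↔ Function.Injective x' := by
  constructor
  · intro hx
    obtain ⟨σ, rfl⟩ := exists_perm_of_range_eq hx hr
    exact hx.comp σ.injective
  · intro hx'
    obtain ⟨σ, rfl⟩ := exists_perm_of_range_eq hx' hr.symm
    exact hx'.comp σ.injective

/-! ## The registered stubs -/

/-- W-range (1): a normalised permutation-symmetric family only depends on the range of the
configuration: if `x` is injective then `x' = x ∘ σ` for a permutation `σ` and we use permutation
symmetry; otherwise neither `x` nor `x'` is injective and both sides vanish. [folklore] -/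
theorem stub_corr_eq_of_range_eq :
    ∀ (S : CorrFamily 3),
      (∀ (n : ℕ) (z : Fin n → EuclideanSpace ℝ (Fin 3)), z ∉ NonCoincident 3 n → S n z = 0) →
      Literature.MathematicalPhysics.QuantumFieldTheory.IsPermutationSymmetric S →
      ∀ (n n' : ℕ), n = n' → ∀ (x : Fin n → EuclideanSpace ℝ (Fin 3)) (x' : Fin n' → EuclideanSpace ℝ (Fin 3)),
        Set.range x = Set.range x' → S n x = S n' x' := by
  intro S h0 hP n n' h
  subst h
  intro x x' hr
  by_cases hx : Function.Injective x
  · obtain ⟨σ, rfl⟩ := exists_perm_of_range_eq hx hr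
    exact (hP n σ x).symm
  · have hx' : ¬ Function.Injective x' := fun h => hx ((injective_iff_of_range_eq hr).2 h)
    rw [h0 n x (fun h => hx ((mem_nonCoincident x).1 h)),
      h0 n x' (fun h => hx' ((mem_nonCoincident x').1 h))]

/-- W-range (2): the same up to a translation: if `Set.range x' = Set.range x + v` then
`S n' x' = S n (x + v) = S n x` by `stub_corr_eq_of_range_eq` and translation invariance.
[folklore] -/
theorem stub_corr_eq_of_range_eq_add :
    ∀ (S : CorrFamily 3),
      (∀ (n : ℕ) (z : Fin n → EuclideanSpace ℝ (Fin 3)), z ∉ NonCoincident 3 n → S n z = 0) →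
      Literature.MathematicalPhysics.QuantumFieldTheory.IsPermutationSymmetric S → IsTranslationInvariant S →
      ∀ (v : EuclideanSpace ℝ (Fin 3)) (n n' : ℕ), n = n' →
        ∀ (x : Fin n → EuclideanSpace ℝ (Fin 3)) (x' : Fin n' → EuclideanSpace ℝ (Fin 3)),
        Set.range x' = (fun p => p + v) '' Set.range x → S n' x' = S n x := by
  intro S h0 hP hT v n n' h
  subst h
  intro x x' hr
  rw [← range_comp_add x v] at hr
  rw [stub_corr_eq_of_range_eq S h0 hP n n rfl x' (fun i => x i + v) hr]
  exact hT n v x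

end Summit.CriticalPhenomena.Ising3DConformalLimit.Cruxes.RotationUpgradeFromTwoPoint.NullLaplacianEdgeGaussianity

end
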